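import Summits.AtomisticToContinuum.Crystallization.Theorems.PerronTransitivityTransitiveLocalLimitEnergeticDoors
import Summits.AtomisticToContinuum.Crystallization.Theorems.TransitiveLocalLimit.Negative.StubSuperBoundSparse
import Summits.AtomisticToContinuum.Crystallization.Theorems.ChessboardParticlePlanesLjLaminarWindowsVirial
import Summits.AtomisticToContinuum.Crystallization.Theses.PRVarianceCertificate

/-!
# Strategy census for crux `PerronTransitivity.TransitiveLocalLimit` (stmt-AtomisticToContinuum-15100) —
# typed signatures (crux-strategist seat `cstrat-…-15100-s1`, 2026-08-17)

Companion of `STRATEGY-CENSUS.md`.  Every heading of the census names a concrete switch; this file types the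
switches over tree declarations so that "no leverage" is a statement about named Props, not prose.

* `SiteEnergyConcentration` — the STRENGTHENING S⁺ (two-sided density concentration of site energies at `2E*`
  along EVERY ground-state sequence); `transitiveLocalLimit_of_siteEnergyConcentration : S⁺ → crux` is the landed
  door `TransitiveLocalLimitBirth.transitiveLocalLimit_of_concentration`.
* `OneCentreFloor` — the TRANSFER of the solved siblings' step (sticky discs/spheres, Theil-type narrow wells:
  every site is bound by at least `2E*`); `siteEnergyConcentration_of_oneCentreFloor : OneCentreFloor → S⁺`
  (PROVED here: one-sided floor + `E(N)/N → E*` squeeze the empirical distribution), and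
  `not_oneCentreFloor_lennardJones : ¬ OneCentreFloor` (PROVED: hedgehog centre of the landed negative file,
  `𝓔 ≤ −3 < −14.316/6 ≤ 2E*`).  The transfer breaks at its first step.
* `FieldConcentration`, `AttractiveConcentration`, `RepulsiveConcentration` — the DECOMPOSITION by the virial
  split `𝓔ⁱ = tᵢ/12 − sᵢ/6` (`tᵢ = Σ r⁻¹²`, `sᵢ = Σ r⁻⁶`; on ground states `Σtᵢ = Σsᵢ`,
  `LjLaminarWindowsSketch.virial_sum_inv_pow_eq`); `siteEnergyConcentration_of_virialSplit` (PROVED) is the glue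
  `AttractiveConcentration → RepulsiveConcentration → S⁺`, and `AttractiveConcentrationOfGSVC` records (as a Prop)
  what the open certificate `PRVarianceCertificate.GroundStateVarianceCertificate` (stmt-11859) would feed.
* `NonTransitiveMinimiser` — the NEGATION target: what a counterexample must contain (typed; no witness exists
  short of beating hcp, see the census).

No `sorry`; nothing here is a route item or a registered line (strategist census only).
-/

noncomputable section

namespace Summit.AtomisticToContinuum.Crystallization.Cruxes.TransitiveLocalLimit.Strategist

open Filter Topology
open scoped BigOperators
open Literature.MathematicalPhysics.StatisticalMechanics
open Summit.AtomisticToContinuum.Crystallization.Theses.PerronTransitivity (TransitiveLocalLimit)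

/-- `E* = ⨅_Q e_LJ(Q)`, the periodic infimum (= `lim E(N)/N`, landed `crysEnergyLimit`); reducible, so that the
statements below unify with the landed doors verbatim. -/
abbrev eStar : ℝ := ⨅ Q : PeriodicConfiguration 3, Q.energyPerParticle lennardJones

local notation "E⋆" => eStar

/-! ## Strengthen: S⁺ = two-sided density concentration along every sequence -/

/-- Density concentration of the `V`-site sums at level `c` along every Lennard-Jones ground-state sequence:
for every `θ > 0` the fraction of particles `i` with `|Σ_{k≠i} V(r_ik) − c| > θ` tends to `0`. -/
def FieldConcentration (V : ℝ → ℝ) (c : ℝ) : Prop :=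
  ∀ x : (N : ℕ) → (Fin N → EuclideanSpace ℝ (Fin 3)), (∀ N, IsGroundState lennardJones (x N)) →
    ∀ θ : ℝ, 0 < θ → Tendsto (fun N : ℕ => ((Finset.univ.filter fun i : Fin N =>
      θ < |siteEnergy V (x N) i - c|).card : ℝ) / N) atTop (nhds 0)

/-- **S⁺ (strengthen).** Site energies concentrate at `2E*` in density along EVERY ground-state sequence
(the crux asks only for ONE energy-transitive local limit along SOME subsequence). Verbatim the hypothesis of the
landed door `transitiveLocalLimit_of_concentration`. -/
def SiteEnergyConcentration : Prop :=
  ∀ x : (N : ℕ) → (Fin N → EuclideanSpace ℝ (Fin 3)), (∀ N, IsGroundState lennardJones (x N)) →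
    ∀ θ : ℝ, 0 < θ → Tendsto (fun N : ℕ => ((Finset.univ.filter fun i : Fin N =>
      θ < |siteEnergy lennardJones (x N) i - 2 * E⋆|).card : ℝ) / N) atTop (nhds 0)

theorem siteEnergyConcentration_iff : SiteEnergyConcentration ↔ FieldConcentration lennardJones (2 * E⋆) :=
  Iff.rfl

/-- **S⁺ → crux** (landed door, `TransitiveLocalLimitBirth.transitiveLocalLimit_of_concentration`). -/
theorem transitiveLocalLimit_of_siteEnergyConcentration (h : SiteEnergyConcentration) : TransitiveLocalLimit :=
  fun x hx => Theorems.TransitiveLocalLimitBirth.transitiveLocalLimit_of_concentration h x hx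

/-! ## Transfer: the solved siblings' step is a ONE-CENTRE FLOOR at the sharp level -/

/-- **One-centre floor at level `L` for `V`**: every site of every finite configuration of distinct points is
bound by at least `L`.  For sticky discs / sticky spheres (`L = −6`, `−12`: kissing numbers) and for Theil-type
narrow wells this holds at `L = 2E*(V)`; it is the first step of every proved crystallization theorem
(Heitmann–Radin 1980, Theil 2006, Flatley–Theil 2015 with three-body terms). -/
def OneCentreFloor (V : ℝ → ℝ) (L : ℝ) : Prop :=
  ∀ (N : ℕ) (x : Fin N → EuclideanSpace ℝ (Fin 3)), Function.Injective x → ∀ i, L ≤ siteEnergy V x i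

/-- **Transfer fails at step one for Lennard-Jones**: the one-centre floor at the crux level `2E*` is FALSE
(hedgehog centre of the landed negative file: `36` spikes at distance `1` give `𝓔 ≤ −3`, while
`2E* ≥ −14.316/6 > −3` by Yuhjtman's stability constant).  For configurations with the ground-state minimal
distance the floor still fails (compressed icosahedral centres, `Literature.Barriers.AtomisticToContinuum.
IcosahedralClusters`), numerically by 2–19 %. -/
theorem not_oneCentreFloor_lennardJones : ¬ OneCentreFloor lennardJones (2 * E⋆) := by
  intro h
  have h1 := h 37 (Theorems.TransitiveLocalLimit.Negative.StubSuperBoundSparse.hedge 37)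
    (Theorems.TransitiveLocalLimit.Negative.StubSuperBoundSparse.hedge_injective 37) ⟨37 * 0, by norm_num⟩
  have h2 := Theorems.TransitiveLocalLimit.Negative.StubSuperBoundSparse.siteEnergy_centre_le
    (N := 37) (q := 0) (by norm_num)
  have h3 := Theorems.TransitiveLocalLimit.Negative.StubSuperBoundSparse.neg_le_two_mul_iInf
  linarith

/-- Mean site energy of a ground state: `Σᵢ 𝓔ⁱ = 2 E(N)` and `N·E* ≤ E(N)`. [folklore] -/
theorem sum_siteEnergy_eq_two_mul {N : ℕ} {x : Fin N → EuclideanSpace ℝ (Fin 3)}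
    (hx : IsGroundState lennardJones x) :
    ∑ i, siteEnergy lennardJones x i = 2 * groundStateEnergy lennardJones 3 N := by
  rw [← two_mul_interactionEnergy, hx.2]

/-- **The siblings' mechanism, typed: a one-centre floor at `2E*` gives S⁺** (hence the crux).  One-sided
floor + `E(N)/N → E*`: `Σᵢ (𝓔ⁱ − 2E*) = 2E(N) − 2N E* = o(N)` with every term `≥ 0`, so
`θ·#{i : |𝓔ⁱ − 2E*| > θ} ≤ 2E(N) − 2N E*`. [folklore] -/
theorem siteEnergyConcentration_of_oneCentreFloor (h : OneCentreFloor lennardJones (2 * E⋆)) :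
    SiteEnergyConcentration := by
  intro x hx θ hθ
  -- the excess per particle tends to zero
  have hlim : Tendsto (fun N : ℕ => groundStateEnergy lennardJones 3 N / N - E⋆) atTop (nhds 0) := by
    have := Theorems.ChargedEnergyGapNegative.crysEnergyLimit.sub_const E⋆
    simpa using this
  have hlim2 : Tendsto (fun N : ℕ => (2 / θ) * (groundStateEnergy lennardJones 3 N / N - E⋆)) atTop
      (nhds 0) := by
    simpa using hlim.const_mul (2 / θ)
  refine tendsto_of_tendsto_of_tendsto_of_le_of_le' tendsto_const_nhds hlim2
    (Filter.Eventually.of_forall fun N => by positivity) ?_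
  filter_upwards [Filter.eventually_gt_atTop 0] with N hN
  -- pointwise for `N ≥ 1`: card/N ≤ (2/θ)(E(N)/N − E*)
  have hNr : (0 : ℝ) < N := by exact_mod_cast hN
  set S := Finset.univ.filter fun i : Fin N => θ < |siteEnergy lennardJones (x N) i - 2 * E⋆| with hS
  set g := groundStateEnergy lennardJones 3 N with hg
  have hfloor : ∀ i : Fin N, 0 ≤ siteEnergy lennardJones (x N) i - 2 * E⋆ := fun i => by
    linarith [h N (x N) (hx N).1 i]
  have hmem : ∀ i ∈ S, θ ≤ siteEnergy lennardJones (x N) i - 2 * E⋆ := by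
    intro i hi
    rw [hS, Finset.mem_filter] at hi
    have := hi.2
    rw [abs_of_nonneg (hfloor i)] at this
    exact this.le
  have hsum : θ * (S.card : ℝ) ≤ ∑ i, (siteEnergy lennardJones (x N) i - 2 * E⋆) := by
    calc θ * (S.card : ℝ) = ∑ i ∈ S, θ := by rw [Finset.sum_const, nsmul_eq_mul, mul_comm]
      _ ≤ ∑ i ∈ S, (siteEnergy lennardJones (x N) i - 2 * E⋆) := Finset.sum_le_sum hmem
      _ ≤ ∑ i, (siteEnergy lennardJones (x N) i - 2 * E⋆) :=
          Finset.sum_le_sum_of_subset_of_nonneg (Finset.subset_univ _) fun i _ _ => hfloor i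
  have htot : ∑ i, (siteEnergy lennardJones (x N) i - 2 * E⋆) = 2 * g - N * (2 * E⋆) := by
    rw [Finset.sum_sub_distrib, sum_siteEnergy_eq_two_mul (hx N), Finset.sum_const, Finset.card_univ,
      Fintype.card_fin, nsmul_eq_mul]
  rw [htot] at hsum
  -- divide by `θ N`
  rw [div_le_iff₀ hNr]
  have hgN : g / N * N = g := div_mul_cancel₀ _ hNr.ne'
  rw [show 2 / θ * (g / N - E⋆) * N = 2 / θ * (g / N * N - E⋆ * N) by ring, hgN, div_mul_eq_mul_div,
    le_div_iff₀ hθ]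
  linarith

/-! ## Decomposition: the virial split -/

/-- Attractive site sums `sᵢ = Σ r⁻⁶` concentrate at `−24E*` (their ground-state mean, by the virial identity
`Σtᵢ = Σsᵢ` and `E(N)/N → E*`). -/
def AttractiveConcentration : Prop := FieldConcentration (fun r => (r⁻¹) ^ 6) (-24 * E⋆)

/-- Repulsive site sums `tᵢ = Σ r⁻¹²` concentrate at `−24E*`. -/
def RepulsiveConcentration : Prop := FieldConcentration (fun r => (r⁻¹) ^ 12) (-24 * E⋆)

/-- The pointwise virial split of a Lennard-Jones site energy about the transitive level. [folklore] -/
theorem siteEnergy_sub_level_eq {N : ℕ} (x : Fin N → EuclideanSpace ℝ (Fin 3)) (i : Fin N) (e : ℝ) :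
    siteEnergy lennardJones x i - 2 * e =
      (1 / 12) * (siteEnergy (fun r => (r⁻¹) ^ 12) x i - (-24 * e)) -
        (1 / 6) * (siteEnergy (fun r => (r⁻¹) ^ 6) x i - (-24 * e)) := by
  simp only [siteEnergy, lennardJones, Finset.sum_sub_distrib, ← Finset.mul_sum]
  ring

/-- **Glue of the virial split (PROVED)**: concentration of both parts gives S⁺.  So the crux follows from
`AttractiveConcentration ∧ RepulsiveConcentration`; the census explains why the second conjunct keeps the whole
kernel. -/
theorem siteEnergyConcentration_of_virialSplit (hs : AttractiveConcentration) (ht : RepulsiveConcentration) :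
    SiteEnergyConcentration := by
  intro x hx θ hθ
  have h6 := hs x hx (3 * θ) (by positivity)
  have h12 := ht x hx (6 * θ) (by positivity)
  have hsub : ∀ N : ℕ, (Finset.univ.filter fun i : Fin N => θ < |siteEnergy lennardJones (x N) i - 2 * E⋆|) ⊆
      (Finset.univ.filter fun i : Fin N =>
          6 * θ < |siteEnergy (fun r => (r⁻¹) ^ 12) (x N) i - (-24 * E⋆)|) ∪
        (Finset.univ.filter fun i : Fin N =>
          3 * θ < |siteEnergy (fun r => (r⁻¹) ^ 6) (x N) i - (-24 * E⋆)|) := by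
    intro N i hi
    rw [Finset.mem_filter] at hi
    rw [Finset.mem_union, Finset.mem_filter, Finset.mem_filter]
    by_contra hcon
    push_neg at hcon
    have h1 := hcon.1 (Finset.mem_univ _)
    have h2 := hcon.2 (Finset.mem_univ _)
    have h3 := hi.2
    rw [siteEnergy_sub_level_eq] at h3
    have h4 := abs_sub ((1 / 12) * (siteEnergy (fun r => (r⁻¹) ^ 12) (x N) i - (-24 * E⋆)))
      ((1 / 6) * (siteEnergy (fun r => (r⁻¹) ^ 6) (x N) i - (-24 * E⋆)))
    rw [abs_mul, abs_mul, abs_of_pos (by norm_num : (0 : ℝ) < 1 / 12),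
      abs_of_pos (by norm_num : (0 : ℝ) < 1 / 6)] at h4
    linarith
  have hcard : ∀ N : ℕ,
      ((Finset.univ.filter fun i : Fin N => θ < |siteEnergy lennardJones (x N) i - 2 * E⋆|).card : ℝ) ≤
        ((Finset.univ.filter fun i : Fin N =>
            6 * θ < |siteEnergy (fun r => (r⁻¹) ^ 12) (x N) i - (-24 * E⋆)|).card : ℝ) +
          ((Finset.univ.filter fun i : Fin N =>
            3 * θ < |siteEnergy (fun r => (r⁻¹) ^ 6) (x N) i - (-24 * E⋆)|).card : ℝ) := by
    intro N
    have := (Finset.card_le_card (hsub N)).trans (Finset.card_union_le _ _)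
    exact_mod_cast this
  have hlim := h12.add h6
  simp only [add_zero] at hlim
  refine tendsto_of_tendsto_of_tendsto_of_le_of_le tendsto_const_nhds hlim (fun N => by positivity)
    (fun N => ?_)
  show _ ≤ _ / _ + _ / _
  rw [← add_div]
  exact div_le_div_of_nonneg_right (hcard N) (Nat.cast_nonneg N)

/-- Hence the split decides the crux (kernel-checked composition). -/
theorem transitiveLocalLimit_of_virialSplit (hs : AttractiveConcentration) (ht : RepulsiveConcentration) :
    TransitiveLocalLimit :=
  transitiveLocalLimit_of_siteEnergyConcentration (siteEnergyConcentration_of_virialSplit hs ht)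

/-- **The attractive half IS fed by an existing open item (PROVED glue)**: the ground-state variance
certificate GSVC (stmt-AtomisticToContinuum-11859, rank-2 crux of route `PRVarianceCertificate`, difficulty
open-problem) gives `AttractiveConcentration`.  With `C ≤ C* := −24E*` (from `E* ≤ e(P) ≤ −C/24`), the virial
identity `Σtᵢ = Σsᵢ = −24E(N)` (`LjLaminarWindowsSketch.virial_sum_inv_pow_eq`, `virial_interactionEnergy_eq`) and
`N E* ≤ E(N) ≤ 0`:  `Σᵢ (sᵢ − C*)² = Σsᵢ² + 48E* Σsᵢ + 576 N E*² ≤ −24 C E(N) − 1152 E* E(N) + 576 N E*²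
≤ −576 E* (E(N) − N E*)`, and `(E(N) − N E*)/N → 0` (`crysEnergyLimit`); Chebyshev. [folklore] -/
theorem attractiveConcentration_of_gsvc (h : Theses.PRVarianceCertificate.GroundStateVarianceCertificate) :
    AttractiveConcentration := by
  obtain ⟨P, C, hC, hP, hvar⟩ := h
  intro x hx θ hθ
  have he : E⋆ ≤ -(C / 24) := (Theorems.ChargedEnergyGapNegative.eStar_le P).trans hP
  have hlim : Tendsto (fun N : ℕ => groundStateEnergy lennardJones 3 N / N - E⋆) atTop (nhds 0) := by
    have := Theorems.ChargedEnergyGapNegative.crysEnergyLimit.sub_const E⋆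
    simpa using this
  have hlim2 : Tendsto (fun N : ℕ => (-(576 : ℝ) * E⋆ / θ ^ 2) *
      (groundStateEnergy lennardJones 3 N / N - E⋆)) atTop (nhds 0) := by
    simpa using hlim.const_mul (-(576 : ℝ) * E⋆ / θ ^ 2)
  refine tendsto_of_tendsto_of_tendsto_of_le_of_le' tendsto_const_nhds hlim2
    (Filter.Eventually.of_forall fun N => by positivity) ?_
  filter_upwards [Filter.eventually_gt_atTop 0] with N hN
  have hNr : (0 : ℝ) < N := by exact_mod_cast hN
  -- the three sums
  have hIs : interactionEnergy (fun r : ℝ => (r⁻¹) ^ 6) (x N) =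
      ∑ i, ∑ j ∈ Finset.Ioi i, (dist (x N i) (x N j))⁻¹ ^ 6 := rfl
  have hIt : interactionEnergy (fun r : ℝ => (r⁻¹) ^ 12) (x N) =
      ∑ i, ∑ j ∈ Finset.Ioi i, (dist (x N i) (x N j))⁻¹ ^ 12 := rfl
  have h2s := two_mul_interactionEnergy (fun r : ℝ => (r⁻¹) ^ 6) (x N)
  have h2t := two_mul_interactionEnergy (fun r : ℝ => (r⁻¹) ^ 12) (x N)
  have hv := Theorems.LjLaminarWindowsSketch.virial_sum_inv_pow_eq (hx N)
  have hvE := Theorems.LjLaminarWindowsSketch.virial_interactionEnergy_eq (hx N)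
  rw [(hx N).2] at hvE
  have hsum_s : ∑ i, siteEnergy (fun r : ℝ => (r⁻¹) ^ 6) (x N) i =
      -24 * groundStateEnergy lennardJones 3 N := by
    rw [← h2s, hIs]; linarith
  have hsum_t : ∑ i, siteEnergy (fun r : ℝ => (r⁻¹) ^ 12) (x N) i =
      -24 * groundStateEnergy lennardJones 3 N := by
    rw [← h2t, hIt, hv, ← hIs]; linarith
  have hNE : (N : ℝ) * E⋆ ≤ groundStateEnergy lennardJones 3 N := by
    have := Theorems.ChargedEnergyGapNegative.card_mul_eStar_le (hx N).1
    rw [(hx N).2] at this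
    exact this
  have hs_nonneg : 0 ≤ ∑ i, siteEnergy (fun r : ℝ => (r⁻¹) ^ 6) (x N) i :=
    Finset.sum_nonneg fun i _ => Finset.sum_nonneg fun k _ => by positivity
  have hE0 : groundStateEnergy lennardJones 3 N ≤ 0 := by linarith
  have hprod : 0 ≤ groundStateEnergy lennardJones 3 N * (C + 24 * E⋆) :=
    mul_nonneg_of_nonpos_of_nonpos hE0 (by linarith)
  -- Chebyshev
  have hcheb : θ ^ 2 * ((Finset.univ.filter fun i : Fin N =>
      θ < |siteEnergy (fun r : ℝ => (r⁻¹) ^ 6) (x N) i - (-24 * E⋆)|).card : ℝ) ≤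
      ∑ i, (siteEnergy (fun r : ℝ => (r⁻¹) ^ 6) (x N) i - (-24 * E⋆)) ^ 2 := by
    calc θ ^ 2 * ((Finset.univ.filter fun i : Fin N =>
          θ < |siteEnergy (fun r : ℝ => (r⁻¹) ^ 6) (x N) i - (-24 * E⋆)|).card : ℝ)
        = ∑ i ∈ (Finset.univ.filter fun i : Fin N =>
            θ < |siteEnergy (fun r : ℝ => (r⁻¹) ^ 6) (x N) i - (-24 * E⋆)|), θ ^ 2 := by
          rw [Finset.sum_const, nsmul_eq_mul, mul_comm]
      _ ≤ ∑ i ∈ (Finset.univ.filter fun i : Fin N =>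
            θ < |siteEnergy (fun r : ℝ => (r⁻¹) ^ 6) (x N) i - (-24 * E⋆)|),
            (siteEnergy (fun r : ℝ => (r⁻¹) ^ 6) (x N) i - (-24 * E⋆)) ^ 2 :=
          Finset.sum_le_sum fun i hi => by
            rw [Finset.mem_filter] at hi
            rw [← sq_abs (siteEnergy (fun r : ℝ => (r⁻¹) ^ 6) (x N) i - (-24 * E⋆))]
            exact pow_le_pow_left₀ hθ.le hi.2.le 2
      _ ≤ ∑ i, (siteEnergy (fun r : ℝ => (r⁻¹) ^ 6) (x N) i - (-24 * E⋆)) ^ 2 :=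
          Finset.sum_le_sum_of_subset_of_nonneg (Finset.subset_univ _) fun i _ _ => sq_nonneg _
  have hexp : ∑ i, (siteEnergy (fun r : ℝ => (r⁻¹) ^ 6) (x N) i - (-24 * E⋆)) ^ 2 =
      ∑ i, (siteEnergy (fun r : ℝ => (r⁻¹) ^ 6) (x N) i) ^ 2 +
        48 * E⋆ * ∑ i, siteEnergy (fun r : ℝ => (r⁻¹) ^ 6) (x N) i + N * (576 * E⋆ ^ 2) := by
    have hpt : ∀ i : Fin N, (siteEnergy (fun r : ℝ => (r⁻¹) ^ 6) (x N) i - (-24 * E⋆)) ^ 2 =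
        (siteEnergy (fun r : ℝ => (r⁻¹) ^ 6) (x N) i) ^ 2 +
          48 * E⋆ * siteEnergy (fun r : ℝ => (r⁻¹) ^ 6) (x N) i + 576 * E⋆ ^ 2 := fun i => by ring
    simp only [hpt, Finset.sum_add_distrib, ← Finset.mul_sum, Finset.sum_const, Finset.card_univ,
      Fintype.card_fin, nsmul_eq_mul]
    ring
  have hvarN : ∑ i, (siteEnergy (fun r : ℝ => (r⁻¹) ^ 6) (x N) i) ^ 2 ≤
      C * (-24 * groundStateEnergy lennardJones 3 N) := by
    rw [← hsum_t]; exact hvar N (x N) (hx N)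
  -- assemble: card * θ² ≤ −576 E⋆ (E(N) − N E⋆)
  rw [div_le_iff₀ hNr,
    show -(576 : ℝ) * E⋆ / θ ^ 2 * (groundStateEnergy lennardJones 3 N / N - E⋆) * N =
      -(576 : ℝ) * E⋆ / θ ^ 2 * (groundStateEnergy lennardJones 3 N / N * N - E⋆ * N) by ring,
    div_mul_cancel₀ _ hNr.ne', div_mul_eq_mul_div, le_div_iff₀ (by positivity : (0 : ℝ) < θ ^ 2)]
  rw [hsum_s] at hexp
  linarith [hcheb, hexp, hvarN, hprod, hNE, hC, hθ, he]

/-- Hence the crux from GSVC and the repulsive half alone (kernel-checked; NOT filed as a split — see census). -/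
theorem transitiveLocalLimit_of_gsvc_of_repulsiveConcentration
    (h : Theses.PRVarianceCertificate.GroundStateVarianceCertificate) (ht : RepulsiveConcentration) :
    TransitiveLocalLimit :=
  transitiveLocalLimit_of_virialSplit (attractiveConcentration_of_gsvc h) ht

/-- The virial identity the split rests on is in tree (any dimension). -/
example {N : ℕ} {x : Fin N → EuclideanSpace ℝ (Fin 3)} (hx : IsGroundState lennardJones x) :
    ∑ i, ∑ j ∈ Finset.Ioi i, (dist (x i) (x j))⁻¹ ^ 12 = ∑ i, ∑ j ∈ Finset.Ioi i, (dist (x i) (x j))⁻¹ ^ 6 :=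
  Theorems.LjLaminarWindowsSketch.virial_sum_inv_pow_eq hx

/-! ## Negation: what a counterexample must contain -/

/-- **A non-transitive zero-excess structure**: an infinite uniformly discrete `X ⊆ ℝ³` whose site sums average
(over the points in large balls about some centre) to `2E*` but are not all equal to `2E*` — e.g. a two-class
Barlow polytype (dhcp, 4H, 9R) IF it were a Lennard-Jones minimiser.  Any counterexample to the crux yields local
limits of this kind (minimising hull, `LINE-REPORT-c4.md`); conversely exhibiting one that is a genuine local
limit of ground states refutes the crux.  Typed here only to make the census's `## Negation` precise. -/
def NonTransitiveMinimiser (X : Set (EuclideanSpace ℝ (Fin 3))) : Prop :=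
  X.Infinite ∧ (∃ δ : ℝ, 0 < δ ∧ ∀ p ∈ X, ∀ q ∈ X, p ≠ q → δ ≤ dist p q) ∧
    (∃ c : EuclideanSpace ℝ (Fin 3), Tendsto (fun R : ℝ =>
      (∑ᶠ p ∈ X ∩ Metric.closedBall c R,
          (∑' q : {q : EuclideanSpace ℝ (Fin 3) // q ∈ X ∧ q ≠ p}, lennardJones (dist p q.1) - 2 * E⋆)) /
        (Nat.card (X ∩ Metric.closedBall c R : Set _) : ℝ)) atTop (nhds 0)) ∧
    ∃ p ∈ X, ∑' q : {q : EuclideanSpace ℝ (Fin 3) // q ∈ X ∧ q ≠ p}, lennardJones (dist p q.1) ≠ 2 * E⋆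

end Summit.AtomisticToContinuum.Crystallization.Cruxes.TransitiveLocalLimit.Strategist

end
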